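import Summits.NavierStokesRegularity.NavierStokesRegularity.Theorems.FilamentSkeletonRssModeCirculation
import Summits.NavierStokesRegularity.NavierStokesRegularity.Theorems.FilamentSkeletonRssProfileOpCurl

/-!
# Route `FilamentSkeletonRss` · crux `SelectionBoxRJ` (stmt-NavierStokesRegularity-21220) — the TORQUE BUDGET on a wall
# circle in FLUX FORM: multipliers on the left, the disc flux of `−ΔW + curl(W × A)` on the right

Lane `ns-filament-19175-p1` (g10).  Helper file `--supports stmt-NavierStokesRegularity-21220 --as helper`; route-independent
assembly of the lineage's `…TorqueBudget` files (ModeCirculation p618724, ProfileOpCurl, TorqueFreePotential p617854) with the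
tree's Stokes theorem on planar discs (`Literature…LoopCirculation.circulation_circleLoop_eq_integral_curl`).

SOURCE OF THE STATEMENT.  F6 verdict memo of the crux-level line `rpi_window_split`
(`Cruxes/SelectionBoxRJ/Lines/rpi_window_split_v6_F6.md`, ns-idea-12 g2, 2026-08-28), §1(b)–(c): «Stokes on `D_R(s)` …
`∫_{D_R(s)} curl(profileOp U)·t dA = …` (TB).  For an ADMISSIBLE triple the left side equals
`Σ_k B_k ∮_{∂D_R(s)} D_k·dl = 2πB_j e^{−s²}(1−e^{−R²}) + Σ_{k≠j} B_k τ_jk(s,R)` … So (TB) is an exact identity relating `B` to the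
circulation profile and the vorticity ON THE WALL.»

WHAT IS KERNEL-CHECKED HERE.
* `torqueBudget_flux` — for `U ∈ C³(ℝ³; ℝ³)` divergence-free, `P ∈ C¹`, continuous modes `D_k` and multipliers `B` with
  `E_α(U) + ∇P = Σ_k B_k D_k` pointwise (the crux's equation clause, `E_α` written out verbatim), the mode `D_j` of the
  crux's shape about the stagnation point `X` with unit tangent `t`, and any orthonormal frame `![t, e₁, e₂]`:
  `B_j · 2π e^{−s²}(1 − e^{−R²}) ⟪t × e₁, e₂⟫ + Σ_{k≠j} B_k ∮_{∂D_R(s)} D_k·dl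
     = ∫₀^R ∫₀^{2π} ρ ⟪(−ΔW + curl(W × A))(X + s t + ρ cos θ e₁ + ρ sin θ e₂), e₁ × e₂⟫ dθ dρ`,
  `W = curl U`, `A = U + ½y − α e₃×y` — the multiplier of filament `j` IS the axial flux of the vorticity-form residual through
  the wall disc, up to the partner modes' wall circulations.  (`e₁ × e₂ = ⟪t × e₁, e₂⟫ t` for an orthonormal frame, so the
  integrand is the axial component; not rewritten here.)
NOT here (memo §1(b) proper): the further split of the disc flux into `−C_R″(s)`, the viscous wall term `−∮∂_ρW_t` and the
transport wall term `∮(A_ρW_t − A_tW_ρ)` — that needs the planar divergence theorem on the disc, which the tree does not hold.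

HONEST FRAMING.  Exact bookkeeping identity about the objects of a HYPOTHETICAL filament-type rotating Leray profile
(refutation-side MODEL rung); nothing here bears on Navier–Stokes regularity or blow-up; no summit statement is proved.
-/

set_option linter.dupNamespace false

noncomputable section

namespace Summit.NavierStokesRegularity.NavierStokesRegularity.Theorems

open Set Function Filter Real MeasureTheory
open Literature.Analysis.FluidPDE
open scoped InnerProductSpace Topology
open Laplacian

namespace TorqueBudget

/-- **The torque budget on the wall circle `∂D_R(s)` of filament `j`, flux form** (F6 memo §1(b)–(c)): see the module
docstring.  Left: the multiplier `B_j` times the closed-form wall circulation of its own mode, plus the partner modes' wall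
circulations; right: the polar flux through the disc of `−ΔW + curl(W × A)`, the vorticity form of `E_α(U)`
(`curl_profileOp_eq_transport`), via Stokes on the disc. [folklore] -/
theorem torqueBudget_flux (α : ℝ) {N : ℕ} {U : EuclideanSpace ℝ (Fin 3) → EuclideanSpace ℝ (Fin 3)}
    (hU : ContDiff ℝ 3 U) (hdiv : VectorCalculus.IsDivFree U)
    {P : EuclideanSpace ℝ (Fin 3) → ℝ} (hP : ContDiff ℝ 1 P) {B : Fin N → ℝ}
    {D : Fin N → EuclideanSpace ℝ (Fin 3) → EuclideanSpace ℝ (Fin 3)} (hD : ∀ k, Continuous (D k))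
    (heq : ∀ y, (α • (cross (EuclideanSpace.single 2 1) (U y) - fderiv ℝ U y (cross (EuclideanSpace.single 2 1) y))
        + (1 / 2 : ℝ) • U y + (1 / 2 : ℝ) • fderiv ℝ U y y - (Δ U) y + fderiv ℝ U y (U y)) + gradient P y
        = ∑ k, B k • D k y)
    (j : Fin N) (X t e₁ e₂ : EuclideanSpace ℝ (Fin 3)) (hon : Orthonormal ℝ ![t, e₁, e₂])
    (hDj : ∀ y, D j y = (Real.exp (-(⟪y - X, t⟫_ℝ) ^ 2) * ((1 - Real.exp (-(‖y - X‖ ^ 2 - ⟪y - X, t⟫_ℝ ^ 2)))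
      / (‖y - X‖ ^ 2 - ⟪y - X, t⟫_ℝ ^ 2))) • cross t (y - X)) (s R : ℝ) :
    B j * (2 * π * (Real.exp (-s ^ 2) * (1 - Real.exp (-R ^ 2))) * ⟪cross t e₁, e₂⟫_ℝ)
        + ∑ k ∈ Finset.univ.erase j, B k * circulation (D k) (circleLoop (X + s • t) R e₁ e₂)
      = ∫ ρ in (0 : ℝ)..R, ∫ θ in (0 : ℝ)..2 * π,
          ρ * ⟪-(Δ (curl U)) (X + s • t + (ρ * cos θ) • e₁ + (ρ * sin θ) • e₂)
              + curl (fun y => cross (curl U y) (U y + (1 / 2 : ℝ) • y - α • cross (EuclideanSpace.single 2 1) y))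
                (X + s • t + (ρ * cos θ) • e₁ + (ρ * sin θ) • e₂), cross e₁ e₂⟫_ℝ := by
  have hE : ContDiff ℝ 1 (fun y => α • (cross (EuclideanSpace.single 2 1) (U y)
      - fderiv ℝ U y (cross (EuclideanSpace.single 2 1) y))
      + (1 / 2 : ℝ) • U y + (1 / 2 : ℝ) • fderiv ℝ U y y - (Δ U) y + fderiv ℝ U y (U y)) := contDiff_lerayOp α hU
  rw [← circulation_profileOp_wallCircle hP hD heq j X t e₁ e₂ hon hDj s R,
    circulation_circleLoop_eq_integral_curl hE]
  refine intervalIntegral.integral_congr (fun ρ _ => ?_)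
  refine intervalIntegral.integral_congr (fun θ _ => ?_)
  simp only [curl_profileOp_eq_transport α hU hdiv]

end TorqueBudget

end Summit.NavierStokesRegularity.NavierStokesRegularity.Theorems
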